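import Summits.BirchSwinnertonDyer.BirchSwinnertonDyer.Theorems.PrintCFramJZeroThreeUnitRegimePsi5K11
import HarnessLib

/-! # K12r@3 — the «3-unit regime» at `p = 3`, BERNOULLI LAYER for a quadratic `ψ` given by an
# INTEGER VALUE FUNCTION (`ψ(a) = v(a)`, any level `f` prime to `3`, EVEN or ODD) and a Heegner
# field `ℚ(√−r)` (`r` prime): Kriz–Li Thm. 1.20's two Bernoulli-unit conditions reduced to finite
# integer certificates in Jacobi-symbol currency (no `Fact` instances at numerals) — even `ψ`: `3 ∤ Σ_{j<fr} v(j)(j/r)j`, `3 ∥ Σ_{j<3f} v(j)(j/3)j`; odd `ψ`: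
# `3 ∤ Σ_{j<f} v(j)j`, `3 ∥ Σ_{j<3fr} v(j)(j/r)(j/3)j` (companion file `…Odd`) — and the binder `hB`
# (cell `bsd-print-cfram`, seat p3 g2; regime N = `TorsionFreeFrameBSDThree`, stmt-BirchSwinnertonDyer-20698)

HONEST FRAMING (cell `bsd-print-cfram`, run/shared/lean/pub/bsd-print-cfram/, D-0131 (2) print
tier; verbatim in every file of the cell): the cell works the partition leaf
`CornerF ∧ p ramified in the CM field K` (LADDER-BSD row K7r = B13; W-ALL row 12r) in PARTITION
currency — a leaf or a cell counts only when its theorem is in the kernel BY NAME. Nothing here is a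
Literature statement, no named fact is introduced, nothing is asserted about BSD; beyond-print: NO
(Dirichlet-character bookkeeping; the value-function form of `…UnitRegimePrimePairBernoulli`, after
bsd-cm's `RouteUKroneckerPsi` at `p = 7`). It serves the remaining characters of
P3-UNIT-REGIME-CENSUS §3: `χ₋₄` (`d* = −1`, odd), `χ₈` (`d* = 2`, even), `χ₄₄` (`d* = 11`, even),
`(·/7)` (`d* = −7`, odd) — and re-derives the Legendre case.

Setting: `ψ : DirichletCharacter ℚ_[3] f` with `ψ(a) = v(a)` (`v : ℕ → ℤ`), `ψ·ψ = 1`, primitive;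
`χ_r = (·/r)` the `ℚ₃`-valued Legendre character mod a prime `r`; `ω` Teichmüller mod `3` (`= (·/3)`).
* §1 (`ψ` EVEN, `θ₁ = ψ⁻¹↑·χ_r↑`, level `f·r`): values `v(j)(j/r)`, primitive (`f ⊥ r`), `≠ 1`,
  `‖B_{1,θ₁}‖₃ = 1 ⟸ 3 ∤ S₁` (`PrintCFram.norm_generalizedBernoulli_one_eq_one_of_intCert`).
* §2 (`ψ` EVEN, `θ₂ = ψ↑·ω⁻¹↑`, level `f·3`): values `v(j)(j/3)`, primitive (`3 ∤ f`), `≠ 1`,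
  `‖B_{1,θ₂}‖₃ = 1 ⟸ 3 ∥ S₂` (bsd-cm `RouteU.norm_generalizedBernoulli_one_eq_one_of_cert`, `e = 0`).
* §3 `bernoulli_hypothesis_three_of_even_values` — the binder `hB` of
  `JZeroThree.bsdp_three_of_thm120_unitRegime` for an EVEN `ψ` and `ε_K = χ_r↑`, modulo the two
  certificates (`PrintCFram.bernoulli_hypothesis_three_of_even`). The ODD case (`ψ₀ = ψε_K`:
  `θ₁ = ψ⁻¹`, `θ₂' = (ψ↑χ_r↑)↑ω⁻¹↑`) is `…UnitRegimeValuePsiBernoulliOdd`.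
References: [KrizLi2019] §1.5 (1) (p. 7, `ψ₀`), Thm. 1.20 (p. 8), §2 (pp. 11–12); [Washington1997]
Ch. 3, §5.1, Thm. 4.2; `X12/O11/RouteUKroneckerPsi.lean`, `RouteUBernoulliCertificate.lean` (bsd-cm).
-/

set_option linter.dupNamespace false
set_option autoImplicit false

noncomputable section

open scoped Classical
open NumberField DirichletCharacter Literature.NumberTheory.EllipticCurves.KrizLi2019
  Literature.NumberTheory.LFunctions
  Summit.BirchSwinnertonDyer.Rank1Residual.X12.O11.RouteU

namespace Summit.BirchSwinnertonDyer.BirchSwinnertonDyer.Theorems.PrintCFram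

/-! ## §0 Value functions -/

section Values

variable {f : ℕ} (ψ : DirichletCharacter ℚ_[3] f) (v : ℕ → ℤ)
  (hv : ∀ a : ℕ, ψ (a : ZMod f) = ((v a : ℤ) : ℚ_[3]))

include hv

/-- A character with integer values `v` vanishes off the units: `v(a) = 0` if `(a, f) ≠ 1`.
[cite: Washington1997, Ch. 3 (Dirichlet characters)] -/
theorem val_eq_zero_of_not_coprime {a : ℕ} (ha : ¬ a.Coprime f) : v a = 0 := by
  have h := hv a
  rw [MulChar.map_nonunit ψ (by rwa [ZMod.isUnit_iff_coprime])] at h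
  exact_mod_cast h.symm

/-- `ψ⁻¹(j) = v(j.val)` for a quadratic `ψ` (`ψ·ψ = 1`). [cite: Washington1997, Ch. 3] -/
theorem inv_apply_eq_val (hψ2 : ψ * ψ = 1) (j : ZMod f) [NeZero f] :
    ψ⁻¹ j = ((v j.val : ℤ) : ℚ_[3]) := by
  rw [inv_eq_of_mul_eq_one_right hψ2, ← ZMod.natCast_zmod_val j, hv, ZMod.natCast_zmod_val]

end Values

/-! ## §1 `ψ` even: `θ₁ = ψ⁻¹↑·χ_r↑` at level `f·r` -/

section ThetaOneEven

variable {f r : ℕ} [hf : NeZero f] [hr : Fact r.Prime]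
  (ψ : DirichletCharacter ℚ_[3] f) (v : ℕ → ℤ) (χr : DirichletCharacter ℚ_[3] r)
  (hv : ∀ a : ℕ, ψ (a : ZMod f) = ((v a : ℤ) : ℚ_[3])) (hψ2 : ψ * ψ = 1)
  (hχr : ∀ a : ℕ, χr (a : ZMod r) = (legendreSym r (a : ℤ) : ℚ_[3]))

include hv hψ2 hχr

/-- Values of `θ₁ = ψ⁻¹↑·χ_r↑` at level `f·r`: `θ₁(j) = v(j)·(j/r)` (both sides vanish off the
units). [cite: KrizLi2019, §2 (p. 11)] -/
theorem thetaOneV_apply (j : ZMod (f * r)) :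
    (changeLevel (dvd_mul_right f r) ψ⁻¹ * changeLevel (dvd_mul_left r f) χr :
      DirichletCharacter ℚ_[3] (f * r)) j =
      ((v j.val * jacobiSym (j.val : ℤ) r : ℤ) : ℚ_[3]) := by
  haveI : NeZero (f * r) := ⟨mul_ne_zero hf.out hr.out.ne_zero⟩
  have hinv : ψ⁻¹ = ψ := inv_eq_of_mul_eq_one_right hψ2
  have hj : ((j.val : ℤ) : ZMod (f * r)) = j := by rw [Int.cast_natCast, ZMod.natCast_zmod_val]
  rw [hinv]
  by_cases hu : IsCoprime (j.val : ℤ) ((f * r : ℕ) : ℤ)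
  · conv_lhs => rw [← hj]
    rw [MulChar.mul_apply, changeLevel_eq_cast_of_dvd' _ _ hu, changeLevel_eq_cast_of_dvd' _ _ hu,
      Int.cast_natCast, Int.cast_natCast, hv, hχr, jacobiSym.legendreSym.to_jacobiSym, Int.cast_mul]
  · have hnu : ¬ IsUnit j := by
      rw [← hj, ZMod.coe_int_isUnit_iff_isCoprime]; exact fun h => hu (by simpa [isCoprime_comm] using h)
    rw [MulChar.map_nonunit _ hnu]
    have hc : ¬ (j.val).Coprime (f * r) := fun h => hu (Nat.isCoprime_iff_coprime.mpr h)
    rw [Nat.coprime_mul_iff_right, not_and_or] at hc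
    rcases hc with h1 | h1
    · rw [val_eq_zero_of_not_coprime ψ v hv h1]; simp
    · have hd : r ∣ j.val := by
        rwa [Nat.coprime_comm, Nat.Prime.coprime_iff_not_dvd hr.out, not_not] at h1
      rw [← jacobiSym.legendreSym.to_jacobiSym r (j.val : ℤ),
        (legendreSym.eq_zero_iff r _).mpr (by rw [Int.cast_natCast]; exact (ZMod.natCast_eq_zero_iff _ _).mpr hd)]
      simp

omit hv hψ2 in
/-- **`θ₁ = ψ⁻¹↑·χ_r↑` is PRIMITIVE of conductor `f·r`** (`ψ` primitive, `f` coprime to the odd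
prime `r`). [cite: Washington1997, Ch. 3 (conductor of a product of characters of coprime conductor)] -/
theorem thetaOneV_isPrimitive (hψp : ψ.IsPrimitive) (hfr : f.Coprime r) (hr2 : r ≠ 2) :
    (changeLevel (dvd_mul_right f r) ψ⁻¹ * changeLevel (dvd_mul_left r f) χr :
      DirichletCharacter ℚ_[3] (f * r)).IsPrimitive := by
  haveI : NeZero (f * r) := ⟨mul_ne_zero hf.out hr.out.ne_zero⟩
  have hcf : ψ⁻¹.conductor = f := by rw [conductor_inv]; exact hψp
  have hcr : χr.conductor = r :=
    conductor_eq_of_prime_of_ne_one χr (legendreChar_three_ne_one χr hχr hr2)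
  rw [isPrimitive_def, conductor_changeLevel_mul_changeLevel _ _ ψ⁻¹ χr (by rwa [hcf, hcr]), hcf, hcr]

omit hv hψ2 in
/-- `θ₁ ≠ 1` (its conductor `f·r` is not `1`). [cite: Washington1997, Ch. 3] -/
theorem thetaOneV_ne_one (hψp : ψ.IsPrimitive) (hfr : f.Coprime r) (hr2 : r ≠ 2) :
    (changeLevel (dvd_mul_right f r) ψ⁻¹ * changeLevel (dvd_mul_left r f) χr :
      DirichletCharacter ℚ_[3] (f * r)) ≠ 1 := by
  haveI : NeZero (f * r) := ⟨mul_ne_zero hf.out hr.out.ne_zero⟩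
  intro h1
  have hc := (eq_one_iff_conductor_eq_one).mp h1
  rw [(isPrimitive_def _).mp (thetaOneV_isPrimitive ψ χr hχr hψp hfr hr2)] at hc
  exact hr.out.one_lt.ne' (Nat.eq_one_of_mul_eq_one_left hc)

/-- **CERTIFICATE 1 (even `ψ`): `‖B_{1,θ₁}‖₃ = 1` from `3 ∤ S₁ = Σ_{j<fr} v(j)(j/r)·j`** (level
`f·r` prime to `3`). [cite: KrizLi2019, Thm. 1.20 (p. 8) and §1.5 (1)] [cite: Washington1997, Thm. 4.2] -/
theorem norm_generalizedBernoulli_thetaOneV (hψp : ψ.IsPrimitive) (hfr : f.Coprime r) (hr2 : r ≠ 2)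
    (hf3 : ¬ 3 ∣ f) (hr3 : r ≠ 3)
    (hS₁ : ¬ ((3 : ℤ) ∣ ∑ j ∈ Finset.range (f * r), v j * jacobiSym (j : ℤ) r * (j : ℤ))) :
    ‖generalizedBernoulli 1 (changeLevel (dvd_mul_right f r) ψ⁻¹ *
        changeLevel (dvd_mul_left r f) χr : DirichletCharacter ℚ_[3] (f * r))‖ = 1 := by
  haveI : NeZero (f * r) := ⟨mul_ne_zero hf.out hr.out.ne_zero⟩
  have h3 : ¬ 3 ∣ f * r := by
    rw [Nat.Prime.dvd_mul Nat.prime_three, not_or]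
    exact ⟨hf3, fun h => hr3 ((Nat.prime_dvd_prime_iff_eq Nat.prime_three hr.out).mp h).symm⟩
  refine norm_generalizedBernoulli_one_eq_one_of_intCert _
    (thetaOneV_ne_one ψ χr hχr hψp hfr hr2) h3 (fun j => v j.val * jacobiSym (j.val : ℤ) r)
    (fun j => thetaOneV_apply ψ v χr hv hψ2 hχr j) ?_
  rwa [sum_univ_zmod_eq_sum_range (fun j => v j * jacobiSym (j : ℤ) r * (j : ℤ))]

end ThetaOneEven

/-! ## §2 `ψ` even: `θ₂ = ψ↑·ω⁻¹↑` at level `f·3` -/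

section ThetaTwoEven

variable {f : ℕ} [hf : NeZero f] (ψ : DirichletCharacter ℚ_[3] f) (v : ℕ → ℤ)
  (ω : DirichletCharacter ℚ_[3] 3)
  (hv : ∀ a : ℕ, ψ (a : ZMod f) = ((v a : ℤ) : ℚ_[3])) (hω : IsTeichmullerCharacter ω)

include hv hω

/-- Values of `θ₂ = ψ↑·ω⁻¹↑` at level `f·3`: `θ₂(j) = v(j)·(j/3)` EXACTLY (`ω⁻¹ = ω = (·/3)`).
[cite: KrizLi2019, §2 (p. 11)] -/
theorem thetaTwoV_apply (j : ZMod (f * 3)) :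
    (changeLevel (dvd_mul_right f 3) ψ * changeLevel (dvd_mul_left 3 f) ω⁻¹ :
      DirichletCharacter ℚ_[3] (f * 3)) j =
      ((v j.val * jacobiSym (j.val : ℤ) 3 : ℤ) : ℚ_[3]) := by
  haveI : NeZero (f * 3) := ⟨mul_ne_zero hf.out (by norm_num)⟩
  have hj : ((j.val : ℤ) : ZMod (f * 3)) = j := by rw [Int.cast_natCast, ZMod.natCast_zmod_val]
  rw [teichmuller_three_inv_eq hω]
  by_cases hu : IsCoprime (j.val : ℤ) ((f * 3 : ℕ) : ℤ)
  · conv_lhs => rw [← hj]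
    rw [MulChar.mul_apply, changeLevel_eq_cast_of_dvd' _ _ hu, changeLevel_eq_cast_of_dvd' _ _ hu,
      Int.cast_natCast, Int.cast_natCast, hv, teichmuller_three_apply_eq_legendreSym hω,
      jacobiSym.legendreSym.to_jacobiSym, Int.cast_mul]
  · have hnu : ¬ IsUnit j := by
      rw [← hj, ZMod.coe_int_isUnit_iff_isCoprime]; exact fun h => hu (by simpa [isCoprime_comm] using h)
    rw [MulChar.map_nonunit _ hnu]
    have hc : ¬ (j.val).Coprime (f * 3) := fun h => hu (Nat.isCoprime_iff_coprime.mpr h)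
    rw [Nat.coprime_mul_iff_right, not_and_or] at hc
    rcases hc with h1 | h1
    · rw [val_eq_zero_of_not_coprime ψ v hv h1]; simp
    · have hd : 3 ∣ j.val := by
        rwa [Nat.coprime_comm, Nat.Prime.coprime_iff_not_dvd Nat.prime_three, not_not] at h1
      rw [← jacobiSym.legendreSym.to_jacobiSym 3 (j.val : ℤ),
        (legendreSym.eq_zero_iff 3 _).mpr (by rw [Int.cast_natCast]; exact (ZMod.natCast_eq_zero_iff _ _).mpr hd)]
      simp

omit hv in
/-- **`θ₂ = ψ↑·ω⁻¹↑` is PRIMITIVE of conductor `f·3`** (`ψ` primitive, `3 ∤ f`). [cite: Washington1997, Ch. 3] -/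
theorem thetaTwoV_isPrimitive (hψp : ψ.IsPrimitive) (hf3 : f.Coprime 3) :
    (changeLevel (dvd_mul_right f 3) ψ * changeLevel (dvd_mul_left 3 f) ω⁻¹ :
      DirichletCharacter ℚ_[3] (f * 3)).IsPrimitive := by
  haveI : NeZero (f * 3) := ⟨mul_ne_zero hf.out (by norm_num)⟩
  have hcf : ψ.conductor = f := hψp
  have hc3 : ω⁻¹.conductor = 3 := by
    rw [conductor_inv]
    exact conductor_eq_of_prime_of_ne_one ω (ne_one_of_isTeichmullerCharacter (by norm_num) hω)
  rw [isPrimitive_def, conductor_changeLevel_mul_changeLevel _ _ ψ ω⁻¹ (by rwa [hcf, hc3]), hcf, hc3]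

omit hv in
/-- `θ₂ ≠ 1` (its conductor `3f` is not `1`). [cite: Washington1997, Ch. 3] -/
theorem thetaTwoV_ne_one (hψp : ψ.IsPrimitive) (hf3 : f.Coprime 3) :
    (changeLevel (dvd_mul_right f 3) ψ * changeLevel (dvd_mul_left 3 f) ω⁻¹ :
      DirichletCharacter ℚ_[3] (f * 3)) ≠ 1 := by
  haveI : NeZero (f * 3) := ⟨mul_ne_zero hf.out (by norm_num)⟩
  intro h1
  have hc := (eq_one_iff_conductor_eq_one).mp h1
  rw [(isPrimitive_def _).mp (thetaTwoV_isPrimitive ψ ω hω hψp hf3)] at hc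
  exact absurd (Nat.eq_one_of_mul_eq_one_left hc) (by norm_num)

/-- **CERTIFICATE 2 (even `ψ`): `‖B_{1,θ₂}‖₃ = 1` from `3 ∥ S₂ = Σ_{j<3f} v(j)(j/3)·j`** (level
`f·3`, `3 ∥ 3f`) — bsd-cm's certificate with exponent `0` (exact values).
[cite: KrizLi2019, Thm. 1.20 (p. 8) and §1.5 (1)] [cite: Washington1997, Thm. 4.2] -/
theorem norm_generalizedBernoulli_thetaTwoV (hψp : ψ.IsPrimitive) (hf3 : f.Coprime 3)
    (hS₂ : (3 : ℤ) ∣ ∑ j ∈ Finset.range (f * 3), v j * jacobiSym (j : ℤ) 3 * (j : ℤ) ^ (0 + 1))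
    (hS₂' : ¬ ((3 : ℤ) ^ 2 ∣ ∑ j ∈ Finset.range (f * 3),
      v j * jacobiSym (j : ℤ) 3 * (j : ℤ) ^ (0 + 1))) :
    ‖generalizedBernoulli 1 (changeLevel (dvd_mul_right f 3) ψ *
        changeLevel (dvd_mul_left 3 f) ω⁻¹ : DirichletCharacter ℚ_[3] (f * 3))‖ = 1 := by
  haveI : NeZero (f * 3) := ⟨mul_ne_zero hf.out (by norm_num)⟩
  have hf3' : ¬ 3 ∣ f := fun h => by
    have := Nat.Coprime.eq_one_of_dvd (Nat.Coprime.symm hf3) h; norm_num at this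
  have hval : padicValNat 3 (f * 3) = 1 := by
    rw [padicValNat.mul hf.out (by norm_num), padicValNat.eq_zero_of_not_dvd hf3', padicValNat_self]
  refine norm_generalizedBernoulli_one_eq_one_of_cert _ (thetaTwoV_ne_one ψ ω hω hψp hf3) hval
    (fun j => v j.val * jacobiSym (j.val : ℤ) 3) 0 (fun j => ?_) ?_ ?_
  · rw [thetaTwoV_apply ψ v ω hv hω j, pow_zero, mul_one, sub_self, norm_zero]
    positivity
  · rwa [sum_univ_zmod_eq_sum_range (fun j => v j * jacobiSym (j : ℤ) 3 * (j : ℤ) ^ (0 + 1))]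
  · rwa [sum_univ_zmod_eq_sum_range (fun j => v j * jacobiSym (j : ℤ) 3 * (j : ℤ) ^ (0 + 1))]

end ThetaTwoEven

/-! ## §3 `hB` from the two certificates (`ψ` even) -/

section Assembly

variable {f r D : ℕ} [hf : NeZero f] [hr : Fact r.Prime] [NeZero D]
  (ψ : DirichletCharacter ℚ_[3] f) (v : ℕ → ℤ) (χr : DirichletCharacter ℚ_[3] r)
  (ω : DirichletCharacter ℚ_[3] 3)
  (hv : ∀ a : ℕ, ψ (a : ZMod f) = ((v a : ℤ) : ℚ_[3])) (hψ2 : ψ * ψ = 1) (hψp : ψ.IsPrimitive)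
  (hχr : ∀ a : ℕ, χr (a : ZMod r) = (legendreSym r (a : ℤ) : ℚ_[3]))
  (hω : IsTeichmullerCharacter ω)
  (hfr : f.Coprime r) (hf3 : f.Coprime 3) (hr2 : r ≠ 2) (hr3 : r ≠ 3) (h : r ∣ D)

include hv hψ2 hψp hχr hω hfr hf3 hr2 hr3

/-- **`hB` for an EVEN value-`ψ` and `ε_K = χ_r↑`**, modulo the two integer certificates
`3 ∤ S₁ = Σ_{j<fr} v(j)(j/r)j` and `3 ∥ S₂ = Σ_{j<3f} v(j)(j/3)j`.
[cite: KrizLi2019, Thm. 1.20 (p. 8, the Bernoulli hypothesis)] -/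
theorem bernoulli_hypothesis_three_of_even_values (hev : ψ.Even)
    (hS₁ : ¬ ((3 : ℤ) ∣ ∑ j ∈ Finset.range (f * r), v j * jacobiSym (j : ℤ) r * (j : ℤ)))
    (hS₂ : (3 : ℤ) ∣ ∑ j ∈ Finset.range (f * 3), v j * jacobiSym (j : ℤ) 3 * (j : ℤ) ^ (0 + 1))
    (hS₂' : ¬ ((3 : ℤ) ^ 2 ∣ ∑ j ∈ Finset.range (f * 3),
      v j * jacobiSym (j : ℤ) 3 * (j : ℤ) ^ (0 + 1))) :
    ¬ (‖bernoulliOnePrim (bernoulliCharOne ψ (changeLevel h χr)) *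
        bernoulliOnePrim (bernoulliCharTwo ψ (changeLevel h χr) ω)‖ ≤ ((3 : ℕ) : ℝ)⁻¹) := by
  have hf3' : ¬ 3 ∣ f := fun hd => by
    have := Nat.Coprime.eq_one_of_dvd (Nat.Coprime.symm hf3) hd; norm_num at this
  exact bernoulli_hypothesis_three_of_even ψ hev χr h ω
    (thetaOneV_isPrimitive ψ χr hχr hψp hfr hr2)
    (norm_generalizedBernoulli_thetaOneV ψ v χr hv hψ2 hχr hψp hfr hr2 hf3' hr3 hS₁)
    (thetaTwoV_isPrimitive ψ ω hω hψp hf3) (norm_generalizedBernoulli_thetaTwoV ψ v ω hv hω hψp hf3 hS₂ hS₂')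

end Assembly

end Summit.BirchSwinnertonDyer.BirchSwinnertonDyer.Theorems.PrintCFram

end
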